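import Literature.RepresentationTheory.CompactGroups.WeylIntegrationCoordinates
import Literature.MathematicalPhysics.QuantumFieldTheory.Balaban1983to89.HaarExponentialChartMeasure

/-!
# Weyl's integral formula for `U(n)`, file 2: the orbit map `(z, θ) ↦ e^{X(z)} (i·diag θ) e^{−X(z)}` on `𝔲(n)` in
# flat coordinates — its derivative `Ad(e^X) ∘ ([jac_X(·), i·diag θ] ⊕ id)` and the Jacobian factorisation
# `det = det(Ad) · j(z) · Π_{j≺k}(θ_j − θ_k)²`

statement-level skeleton of published theorems with citation tags; proofs where landed; nothing here is a claim
about the Yang–Mills mass gap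

Mega-formalization `lit-balaban` (HOME `run/shared/lean/pub/lit-balaban/`), unit `lit-balaban-p28` gen 15 (Phase-2 proof
seat, free-target protocol G.5-34(d), TAKING 2026-08-23T07:08Z): FILE 2 of the discharge of the tree's named fact
`Literature.RepresentationTheory.CompactGroups.weylIntegralFormula_unitary` ([BtD] IV (1.11), `G = U(n)`).  The printed
proof computes the determinant of the conjugation map `q : G/T × T → G`, `(gT, t) ↦ gtg⁻¹` ((1.8): `det q =
det(Ad_{G/T}(t⁻¹) − E)`, block-triangular with `E_T` in the torus block).  This file does the same ONE LEVEL DOWN, on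
the Lie algebra (Helgason's «Lie algebra case», [Hel] Ch. I §5 Thm. 5.17 (22): `|det dφ_{(k₀M, H₀)}| = Π_α |α(H₀)|^{m_α}`
for the map `φ(kM, H) = Ad(k)H`, here `K = U(n)` acting on the Hermitian ≅ skew-Hermitian matrices, `m_α = 2`): in the
flat coordinates `Coord n = 𝔪 × 𝔱` of file 1 the ORBIT MAP
`orbitMap (z, θ) = fromMat (e^{X} · i·diag θ · e^{−X})`, `X = offMat z ∈ 𝔪`,
has derivative `v ↦ fromMat (e^{X} ([J v, D] + i·diag v₂) e^{−X})`, `J v = jac_X(offMat v₁) = e^{−X}·D exp_X(offMat v₁)`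
(r10's `B13HaarSigmaJacobian.jac`, [Hel] Thm. 1.14 (12)), `D = i·diag θ`; it factors as
`AdCoord(e^X) ∘ (scale(rootWeight θ) ∘ N z) × id_𝔱`, so that
**`det(orbitDeriv (z, θ)) = det(AdCoord e^X) · det(N z) · Π_{j≺k} (θ_j − θ_k)²`** with `N 0 = id`.

WHAT IS PROVED (definitions with bodies + theorems; 0 named facts, 0 sorry): §1 `liePt`, `Jmap`, `diagIL`, `offMatL`,
`orbitMat`, `orbitMap`, `AdCoord`, `Nmap`; §2 `hasFDerivAt_exp_offMat` (chain rule through r10's `hasFDerivAt_expChart`),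
`hasFDerivAt_orbitMat`, **`hasFDerivAt_orbitMap`**; §3 `orbitDeriv_eq_AdCoord_comp`, `innerMap_eq_prodMap`,
**`det_orbitDeriv`**, `Nmap_zero`, `AdCoord_one`, `det_orbitDeriv_zero`; §4 `contDiff_orbitMap` (exp is analytic),
`orbitDeriv_eq_fderiv`, **`continuous_orbitDeriv`**, `continuous_det_orbitDeriv`.

HONEST SCOPE. Calculus in flat coordinates only; no measure theory. The factor `det(AdCoord u)` is identified with `±1`
for unitary `u` in file 3, not here.

## References
* Th. Bröcker, T. tom Dieck, *Representations of Compact Lie Groups*, GTM 98 (1985), Ch. IV (1.8)–(1.11) pp. 161–163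
  (held: `book:brockernd-representations-compact-lie-groups`, p0152–p0153). [BrockerTomDieck1985]
* S. Helgason, *Groups and Geometric Analysis*, AMS Surveys 83 (2000), Ch. I §5 Thm. 5.17 and (22) (held:
  `book:helgason2000-groups-geometric-analysis`, p0186); Ch. I §1 Thm. 1.14 (12) p. 96. [Helgason2000]
-/

noncomputable section

open Complex Matrix NormedSpace
open scoped ComplexConjugate Matrix.Norms.L2Operator

namespace Literature.RepresentationTheory.CompactGroups.WeylIntegration

open Literature.MathematicalPhysics.QuantumFieldTheory.Balaban1983to89 (unitaryLogChart mem_unitaryLogChart_lie)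
open Literature.MathematicalPhysics.QuantumFieldTheory.Balaban1983to89.B13HaarSigmaJacobian
  (jac coe_jac_apply jac_zero hasFDerivAt_expChart)
open Literature.MathematicalPhysics.QuantumFieldTheory.Balaban1983to89.HaarExponentialChart (lie_adStable_unitaryGroup)
open Literature.Analysis.Calculus.ExpDifferential (exp_mul_exp_neg_eq_one exp_neg_mul_exp_eq_one)

variable {n : Type*} [Fintype n] [DecidableEq n]

/-! ## §1 The objects -/

/-- The base point `X(z) = offMat z ∈ 𝔪 ⊂ 𝔲(n)` as an element of the Lie algebra `(unitaryLogChart n).lie`.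
[cite: BrockerTomDieck1985, IV (1.12) Ex. 4 p0154] -/
def liePt (z : OD n → ℂ) : (unitaryLogChart n).lie := toLie (z, (0 : n → ℝ))

/-- `liePt z = offMat z` as a matrix. [cite: BrockerTomDieck1985, IV (1.12) Ex. 4 p0154] -/
@[simp] theorem coe_liePt (z : OD n → ℂ) : ((liePt z : (unitaryLogChart n).lie) : Matrix n n ℂ) = offMat z := by
  simp [liePt]

/-- `x ↦ offMat x₁` as a continuous linear map `Coord n →L[ℝ] M_n(ℂ)`. [cite: BrockerTomDieck1985, IV (1.12) Ex. 4 p0154] -/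
def offMatL : Coord n →L[ℝ] Matrix n n ℂ :=
  toMatL.comp ((ContinuousLinearMap.inl ℝ (OD n → ℂ) (n → ℝ)).comp (ContinuousLinearMap.fst ℝ (OD n → ℂ) (n → ℝ)))

/-- [cite: BrockerTomDieck1985, IV (1.12) Ex. 4 p0154] -/
@[simp] theorem offMatL_apply (x : Coord n) : offMatL x = offMat x.1 := by
  simp [offMatL]

/-- `τ ↦ i·diag τ` as a continuous linear map. [cite: BrockerTomDieck1985, IV (3.1) p0160] -/
def diagIL : (n → ℝ) →L[ℝ] Matrix n n ℂ := toMatL.comp (ContinuousLinearMap.inr ℝ (OD n → ℂ) (n → ℝ))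

/-- [cite: BrockerTomDieck1985, IV (3.1) p0160] -/
@[simp] theorem diagIL_apply (τ : n → ℝ) : diagIL τ = diagI τ := by
  simp [diagIL]

/-- **`J_z v = jac_{X(z)}(offMat v₁) ∈ 𝔲(n)` as a matrix**: the trivialised differential `e^{−X}·D exp_X` of the
exponential map ([Hel] Thm. 1.14 (12), r10's `jac`) applied to the `𝔪`-component of `v`.
[cite: Helgason2000, Ch. I §1 Thm. 1.14 (12) p. 96] -/
def Jmap (z : OD n → ℂ) : Coord n →L[ℝ] Matrix n n ℂ :=
  ((unitaryLogChart n).lie.subtypeL.comp (jac (lie_adStable_unitaryGroup (n := n)) (liePt z))).comp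
    ((toLie (n := n) : Coord n →L[ℝ] (unitaryLogChart n).lie).comp
      ((ContinuousLinearMap.inl ℝ (OD n → ℂ) (n → ℝ)).comp (ContinuousLinearMap.fst ℝ (OD n → ℂ) (n → ℝ))))

/-- `J_z v = (jac (liePt z) (toLie (v₁, 0)) : M_n(ℂ))`. [cite: Helgason2000, Ch. I §1 Thm. 1.14 (12) p. 96] -/
theorem Jmap_apply (z : OD n → ℂ) (v : Coord n) :
    Jmap z v = ((jac (lie_adStable_unitaryGroup (n := n)) (liePt z) (toLie (v.1, (0 : n → ℝ))) :
      (unitaryLogChart n).lie) : Matrix n n ℂ) := rfl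

/-- `J_z v` is skew-Hermitian. [cite: Helgason2000, Ch. I §1 Thm. 1.14 (12) p. 96] -/
theorem star_Jmap (z : OD n → ℂ) (v : Coord n) : star (Jmap z v) = -Jmap z v :=
  mem_unitaryLogChart_lie.1 (Subtype.mem _)

omit [DecidableEq n] in
/-- `offMat 0 = 0`. [cite: BrockerTomDieck1985, IV (1.12) Ex. 4 p0154] -/
theorem offMat_zero : offMat (0 : OD n → ℂ) = 0 := by
  ext j k; unfold offMat; split_ifs <;> simp

/-- `liePt 0 = 0`. [cite: BrockerTomDieck1985, IV (1.12) Ex. 4 p0154] -/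
theorem liePt_zero : liePt (0 : OD n → ℂ) = 0 :=
  Subtype.ext (by rw [coe_liePt, offMat_zero]; rfl)

/-- At `z = 0`: `J_0 v = offMat v₁` (`jac 0 = 1`). [cite: Helgason2000, Ch. I §1 Thm. 1.14 (12) p. 96] -/
theorem Jmap_zero (v : Coord n) : Jmap (0 : OD n → ℂ) v = offMat v.1 := by
  rw [Jmap_apply, liePt_zero, jac_zero]
  simp

/-- THE ORBIT MAP at matrix level: `(z, θ) ↦ e^{X} (i·diag θ) e^{−X}`, `X = offMat z` — Helgason's
`φ(kM, H) = Ad(k)H` with `k = e^{X}` running over the transversal `e^𝔪` to `T`.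
[cite: Helgason2000, Ch. I §5 Thm. 5.17 p0186] -/
def orbitMat (x : Coord n) : Matrix n n ℂ := exp (offMat x.1) * diagI x.2 * exp (-offMat x.1)

/-- THE ORBIT MAP in flat coordinates: `orbitMap x = fromMat (e^{X} (i·diag θ) e^{−X})`.
[cite: Helgason2000, Ch. I §5 Thm. 5.17 p0186] -/
def orbitMap (x : Coord n) : Coord n := fromMat (orbitMat x)

/-- `Ad(u)` in flat coordinates: `v ↦ fromMat (u · toMat v · u*)`. [cite: BrockerTomDieck1985, IV (1.8) p0152] -/
def AdCoord (u : Matrix n n ℂ) : Coord n →L[ℝ] Coord n :=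
  fromMatL.comp ((ContinuousLinearMap.mulLeftRight ℝ (Matrix n n ℂ) u (star u)).comp toMatL)

/-- [cite: BrockerTomDieck1985, IV (1.8) p0152] -/
@[simp] theorem AdCoord_apply (u : Matrix n n ℂ) (v : Coord n) : AdCoord u v = fromMat (u * toMat v * star u) := by
  simp [AdCoord]

/-- The `𝔪`-block `N z : ζ ↦ offCoord (jac_{X(z)} (offMat ζ))` of the trivialised differential (`N 0 = id`).
[cite: Helgason2000, Ch. I §5 Thm. 5.17 (22) p0186] -/
def Nmap (z : OD n → ℂ) : (OD n → ℂ) →L[ℝ] (OD n → ℂ) :=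
  ((ContinuousLinearMap.fst ℝ (OD n → ℂ) (n → ℝ)).comp (fromMatL.comp (Jmap z))).comp
    (ContinuousLinearMap.inl ℝ (OD n → ℂ) (n → ℝ))

/-- [cite: Helgason2000, Ch. I §5 Thm. 5.17 (22) p0186] -/
theorem Nmap_apply (z ζ : OD n → ℂ) : Nmap z ζ = offCoord (Jmap z (ζ, 0)) := rfl

/-- `N 0 = id`. [cite: Helgason2000, Ch. I §5 Thm. 5.17 (22) p0186] -/
theorem Nmap_zero : Nmap (0 : OD n → ℂ) = ContinuousLinearMap.id ℝ (OD n → ℂ) := by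
  ext1 ζ
  rw [Nmap_apply, Jmap_zero, ContinuousLinearMap.id_apply]
  have := fromMat_toMat (ζ, (0 : n → ℝ))
  rw [toMat_zero_right] at this
  exact congrArg Prod.fst this

/-! ## §2 The derivative of the orbit map -/

/-- `e^{−X} = (e^{X})*` for `X = offMat z` skew-Hermitian. [cite: Helgason2000, Ch. I §1 Thm. 1.14 (12) p. 96] -/
theorem exp_neg_offMat (z : OD n → ℂ) : exp (-offMat z) = star (exp (offMat z)) := by
  letI : NormedAlgebra ℚ (Matrix n n ℂ) := NormedAlgebra.restrictScalars ℚ ℂ _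
  rw [← toMat_zero_right, ← star_toMat, star_exp]

/-- **Chain rule through the exponential chart**: `x ↦ e^{offMat x₁}` has derivative `v ↦ e^{X} · J_z v` at `x = (z, θ)`
(r10's `hasFDerivAt_expChart`: `y ↦ e^{−X}e^{y}` has derivative `ι ∘ jac X`).
[cite: Helgason2000, Ch. I §1 Thm. 1.14 (12) p. 96] -/
theorem hasFDerivAt_exp_offMat (x : Coord n) :
    HasFDerivAt (fun y : Coord n => exp (offMat y.1))
      ((ContinuousLinearMap.mul ℝ (Matrix n n ℂ) (exp (offMat x.1))).comp (Jmap x.1)) x := by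
  -- the linear map `ℓ : y ↦ toLie (y₁, 0)` with `ℓ x = liePt x₁`
  set ℓ : Coord n →L[ℝ] (unitaryLogChart n).lie :=
    ((toLie (n := n) : Coord n →L[ℝ] (unitaryLogChart n).lie).comp
      ((ContinuousLinearMap.inl ℝ (OD n → ℂ) (n → ℝ)).comp (ContinuousLinearMap.fst ℝ (OD n → ℂ) (n → ℝ)))) with hℓ
  have hℓx : ℓ x = liePt x.1 := rfl
  have hℓy : ∀ y : Coord n, ((ℓ y : (unitaryLogChart n).lie) : Matrix n n ℂ) = offMat y.1 := fun y => by
    simp [hℓ]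
  -- r10: `w ↦ e^{−X} e^{w}` on `𝔲(n)` has derivative `ι ∘ jac X` at `X = liePt x₁`
  have h1 := hasFDerivAt_expChart (𝕂 := ℝ) (lie_adStable_unitaryGroup (n := n)) (liePt x.1)
  rw [← hℓx] at h1
  have h3 := h1.comp x ℓ.hasFDerivAt
  -- multiply back by `e^{X}` on the left
  have h4 := h3.const_mul (exp (offMat x.1))
  refine (h4.congr_of_eventuallyEq ?_).congr_fderiv ?_
  · filter_upwards with y
    simp only [Function.comp_apply, hℓy]
    rw [← mul_assoc, exp_mul_exp_neg_eq_one (𝕂 := ℂ), one_mul]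
  · refine ContinuousLinearMap.ext fun v => ?_
    simp only [_root_.smul_apply, ContinuousLinearMap.comp_apply, Submodule.subtypeL_apply,
      ContinuousLinearMap.mul_apply', smul_eq_mul, Jmap_apply]
    rfl


/-- `y ↦ i·diag y₂` has derivative `diagIL ∘ snd`. [cite: BrockerTomDieck1985, IV (1.8) p0152] -/
theorem hasFDerivAt_diagI (x : Coord n) :
    HasFDerivAt (fun y : Coord n => diagI y.2) (diagIL.comp (ContinuousLinearMap.snd ℝ (OD n → ℂ) (n → ℝ))) x :=
  ((diagIL (n := n)).comp (ContinuousLinearMap.snd ℝ (OD n → ℂ) (n → ℝ))).hasFDerivAt.congr_of_eventuallyEq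
    (Filter.Eventually.of_forall fun y => by simp)

/-- `y ↦ e^{−offMat y₁} = (e^{offMat y₁})*` has derivative `v ↦ (e^{X} J_z v)* = −(J_z v)·e^{−X}`.
[cite: Helgason2000, Ch. I §1 Thm. 1.14 (12) p. 96] -/
theorem hasFDerivAt_exp_neg_offMat (x : Coord n) :
    HasFDerivAt (fun y : Coord n => exp (-offMat y.1))
      (((starL' ℝ : Matrix n n ℂ ≃L[ℝ] Matrix n n ℂ) : Matrix n n ℂ →L[ℝ] Matrix n n ℂ).comp
        ((ContinuousLinearMap.mul ℝ (Matrix n n ℂ) (exp (offMat x.1))).comp (Jmap x.1))) x := by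
  have h := ((starL' ℝ : Matrix n n ℂ ≃L[ℝ] Matrix n n ℂ) : Matrix n n ℂ →L[ℝ] Matrix n n ℂ).hasFDerivAt.comp x
    (hasFDerivAt_exp_offMat x)
  refine h.congr_of_eventuallyEq (Filter.Eventually.of_forall fun y => ?_)
  simp only [Function.comp_apply, ContinuousLinearEquiv.coe_coe, starL'_apply, exp_neg_offMat]

/-- The inner (matrix-valued) linear map `v ↦ [J_z v, D] + i·diag v₂`, `D = i·diag θ`.
[cite: BrockerTomDieck1985, IV (1.8) p0152] -/
def innerMat (x : Coord n) : Coord n →L[ℝ] Matrix n n ℂ :=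
  (ContinuousLinearMap.mulLeftRight ℝ (Matrix n n ℂ) 1 (diagI x.2)).comp (Jmap x.1) -
    (ContinuousLinearMap.mul ℝ (Matrix n n ℂ) (diagI x.2)).comp (Jmap x.1) +
    diagIL.comp (ContinuousLinearMap.snd ℝ (OD n → ℂ) (n → ℝ))

/-- [cite: BrockerTomDieck1985, IV (1.8) p0152] -/
@[simp] theorem innerMat_apply (x v : Coord n) :
    innerMat x v = Jmap x.1 v * diagI x.2 - diagI x.2 * Jmap x.1 v + diagI v.2 := by
  simp [innerMat]

/-- `innerMat x v` is skew-Hermitian. [cite: BrockerTomDieck1985, IV (1.12) Ex. 4 p0154] -/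
theorem star_innerMat (x v : Coord n) : star (innerMat x v) = -innerMat x v := by
  have hD : star (diagI x.2) = -diagI x.2 := by rw [← toMat_zero_left, star_toMat]
  have hτ : star (diagI v.2) = -diagI v.2 := by rw [← toMat_zero_left, star_toMat]
  rw [innerMat_apply, star_add, star_sub, star_mul, star_mul, hD, hτ, star_Jmap]
  noncomm_ring

/-- The inner linear map in coordinates: `v ↦ fromMat ([J_z v, D] + i·diag v₂)`.
[cite: BrockerTomDieck1985, IV (1.8) p0152] -/
def innerMap (x : Coord n) : Coord n →L[ℝ] Coord n := fromMatL.comp (innerMat x)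

/-- [cite: BrockerTomDieck1985, IV (1.8) p0152] -/
@[simp] theorem innerMap_apply (x v : Coord n) : innerMap x v = fromMat (innerMat x v) := rfl

/-- THE DERIVATIVE of the orbit map in coordinates: `Ad(e^X) ∘ inner` («the determinant of the conjugation map … in
matrix form», (1.8)). [cite: BrockerTomDieck1985, IV (1.8) p0152] -/
def orbitDeriv (x : Coord n) : Coord n →L[ℝ] Coord n := (AdCoord (exp (offMat x.1))).comp (innerMap x)

/-- **The derivative of the matrix orbit map**: `D(e^X D e^{−X})_x(v) = e^{X} ([J_z v, D] + i·diag v₂) e^{−X}`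
(product rule + [Hel] Thm. 1.14 (12) for the two exponentials).
[cite: Helgason2000, Ch. I §5 Thm. 5.17 (22) p0186] -/
theorem hasFDerivAt_orbitMat (x : Coord n) :
    HasFDerivAt (orbitMat (n := n))
      ((ContinuousLinearMap.mulLeftRight ℝ (Matrix n n ℂ) (exp (offMat x.1)) (star (exp (offMat x.1)))).comp
        (innerMat x)) x := by
  have h := ((hasFDerivAt_exp_offMat x).mul' (hasFDerivAt_diagI x)).mul' (hasFDerivAt_exp_neg_offMat x)
  have hfun : (fun y : Coord n => exp (offMat y.1)) * (fun y : Coord n => diagI y.2) * (fun y : Coord n =>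
      exp (-offMat y.1)) = orbitMat := by
    funext y; simp [orbitMat]
  rw [hfun] at h
  refine h.congr_fderiv (ContinuousLinearMap.ext fun v => ?_)
  simp only [_root_.add_apply, _root_.smul_apply, ContinuousLinearMap.comp_apply,
    ContinuousLinearMap.mul_apply', ContinuousLinearEquiv.coe_coe, starL'_apply, smul_eq_mul,
    ContinuousLinearMap.mulLeftRight_apply, innerMat_apply, star_mul, diagIL_apply, ContinuousLinearMap.coe_snd',
    star_Jmap, exp_neg_offMat, MulOpposite.smul_eq_mul_unop, MulOpposite.unop_op, Pi.mul_apply]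
  noncomm_ring

/-- **The derivative of the orbit map in flat coordinates**: `orbitDeriv x = AdCoord(e^X) ∘ innerMap x`.
[cite: Helgason2000, Ch. I §5 Thm. 5.17 (22) p0186] -/
theorem hasFDerivAt_orbitMap (x : Coord n) : HasFDerivAt (orbitMap (n := n)) (orbitDeriv x) x := by
  have h := (fromMatL (n := n)).hasFDerivAt.comp x (hasFDerivAt_orbitMat x)
  have hfun : (fromMatL (n := n)) ∘ orbitMat = orbitMap := by funext y; simp [orbitMap]
  rw [hfun] at h
  refine h.congr_fderiv (ContinuousLinearMap.ext fun v => ?_)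
  simp only [ContinuousLinearMap.comp_apply, fromMatL_apply, ContinuousLinearMap.mulLeftRight_apply, orbitDeriv,
    AdCoord_apply, innerMap_apply]
  rw [toMat_fromMat (star_innerMat x v)]

/-! ## §3 The Jacobian factorisation `det = det(AdCoord e^X) · det(N z) · Π_{j≺k}(θ_j − θ_k)²` -/

/-- `fromMat (i·diag τ) = (0, τ)`. [cite: BrockerTomDieck1985, IV (3.1) p0160] -/
theorem fromMat_diagI (τ : n → ℝ) : fromMat (diagI τ) = ((0 : OD n → ℂ), τ) := by
  rw [← toMat_zero_left, fromMat_toMat]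

/-- `J_z (ζ, τ) = J_z (ζ, 0)` (the differential of the transversal sees only the `𝔪`-component).
[cite: Helgason2000, Ch. I §5 Thm. 5.17 (22) p0186] -/
theorem Jmap_apply_eq (z : OD n → ℂ) (v : Coord n) : Jmap z v = Jmap z (v.1, (0 : n → ℝ)) := rfl

/-- **Block form of the inner map** ((1.8) «In matrix form this is `[[Ad − E, 0], [·, E_T]]`», here on the Lie
algebra): `innerMap (z, θ) = (scale (rootWeight θ) ∘ N z) × id_𝔱`.
[cite: BrockerTomDieck1985, IV (1.8) p0152–p0153] -/
theorem innerMap_eq_prodMap (x : Coord n) :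
    innerMap x = ((scale (rootWeight x.2)).comp (Nmap x.1)).prodMap (ContinuousLinearMap.id ℝ (n → ℝ)) := by
  refine ContinuousLinearMap.ext fun v => ?_
  obtain ⟨ζ, τ⟩ := v
  rw [ContinuousLinearMap.coe_prodMap', Prod.map_apply, ContinuousLinearMap.id_apply,
    ContinuousLinearMap.comp_apply, innerMap_apply, innerMat_apply, ← fromMatₗ_apply, map_add, fromMatₗ_apply,
    fromMatₗ_apply, fromMat_comm_diagI, fromMat_diagI, Prod.mk_add_mk, zero_add, add_zero, Nmap_apply,
    Jmap_apply_eq x.1 (ζ, τ)]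
  rfl

/-- **`det(orbitDeriv (z, θ)) = det(AdCoord e^X) · (det(N z) · Π_{j≺k} (θ_j − θ_k)²)`** — (1.8)'s
`det q = det(Ad_{G/T}(t⁻¹) − E)`, Lie-algebra version with the transversal Jacobian `det N z` (`= 1` at `z = 0`).
[cite: BrockerTomDieck1985, IV (1.8) p0152] [cite: Helgason2000, Ch. I §5 Thm. 5.17 (22) p0186] -/
theorem det_orbitDeriv (x : Coord n) :
    (orbitDeriv x).det =
      (AdCoord (exp (offMat x.1))).det * ((Nmap x.1).det * ∏ p : OD n, (x.2 p.1.1 - x.2 p.1.2) ^ 2) := by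
  have hcomp : ∀ f g : Coord n →L[ℝ] Coord n, (f.comp g).det = f.det * g.det := fun f g =>
    LinearMap.det_comp (f : Coord n →ₗ[ℝ] Coord n) (g : Coord n →ₗ[ℝ] Coord n)
  have hcomp' : ∀ f g : (OD n → ℂ) →L[ℝ] (OD n → ℂ), (f.comp g).det = f.det * g.det := fun f g =>
    LinearMap.det_comp (f : (OD n → ℂ) →ₗ[ℝ] (OD n → ℂ)) (g : (OD n → ℂ) →ₗ[ℝ] (OD n → ℂ))
  have hprod : ∀ (f : (OD n → ℂ) →L[ℝ] (OD n → ℂ)) (g : (n → ℝ) →L[ℝ] (n → ℝ)),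
      (f.prodMap g).det = f.det * g.det := fun f g => by
    rw [ContinuousLinearMap.det, ContinuousLinearMap.coe_prodMap, LinearMap.det_prodMap]
  have hid : (ContinuousLinearMap.id ℝ (n → ℝ)).det = 1 := LinearMap.det_id
  rw [orbitDeriv, hcomp, innerMap_eq_prodMap, hprod, hid, mul_one, hcomp', det_scale_rootWeight,
    mul_comm (∏ p : OD n, _)]

/-- `AdCoord 1 = id`. [cite: BrockerTomDieck1985, IV (1.8) p0152] -/
theorem AdCoord_one : AdCoord (1 : Matrix n n ℂ) = ContinuousLinearMap.id ℝ (Coord n) := by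
  refine ContinuousLinearMap.ext fun v => ?_
  rw [AdCoord_apply, star_one, one_mul, mul_one, fromMat_toMat, ContinuousLinearMap.id_apply]

/-- At the torus (`z = 0`): `det(orbitDeriv (0, θ)) = Π_{j≺k} (θ_j − θ_k)²` («`det(E_{G/T} − Ad_{G/T}(t⁻¹))`» of
(1.11), Lie-algebra form). [cite: BrockerTomDieck1985, IV (1.11) p0153] -/
theorem det_orbitDeriv_zero (θ : n → ℝ) :
    (orbitDeriv ((0 : OD n → ℂ), θ)).det = ∏ p : OD n, (θ p.1.1 - θ p.1.2) ^ 2 := by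
  have hid : ∀ {V : Type _} [NormedAddCommGroup V] [NormedSpace ℝ V], (ContinuousLinearMap.id ℝ V).det = 1 :=
    fun {V} _ _ => LinearMap.det_id
  rw [det_orbitDeriv, offMat_zero, NormedSpace.exp_zero, AdCoord_one, Nmap_zero, hid, hid, one_mul, one_mul]

/-! ## §4 Smoothness; the derivative is continuous -/

/-- `exp` is smooth on `M_n(ℂ)` (as a real Banach algebra). [cite: Helgason2000, Ch. I §1 Thm. 1.14 (12) p. 96] -/
theorem contDiff_exp_matrix {m : WithTop ℕ∞} : ContDiff ℝ m (fun A : Matrix n n ℂ => exp A) :=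
  contDiff_iff_contDiffAt.2 fun A => (NormedSpace.exp_analytic A).contDiffAt

/-- The orbit map is smooth. [cite: Helgason2000, Ch. I §5 Thm. 5.17 p0186] -/
theorem contDiff_orbitMap {m : WithTop ℕ∞} : ContDiff ℝ m (orbitMap (n := n)) := by
  have h1 : ContDiff ℝ m (fun y : Coord n => exp (offMat y.1)) := by
    have : (fun y : Coord n => exp (offMat y.1)) = (fun A : Matrix n n ℂ => exp A) ∘ offMatL := by
      funext y; simp
    rw [this]; exact contDiff_exp_matrix.comp (offMatL (n := n)).contDiff
  have h2 : ContDiff ℝ m (fun y : Coord n => diagI y.2) := by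
    have : (fun y : Coord n => diagI y.2) = diagIL ∘ (ContinuousLinearMap.snd ℝ (OD n → ℂ) (n → ℝ)) := by
      funext y; simp
    rw [this]; exact diagIL.contDiff.comp (ContinuousLinearMap.snd ℝ (OD n → ℂ) (n → ℝ)).contDiff
  have h3 : ContDiff ℝ m (fun y : Coord n => exp (-offMat y.1)) := by
    have : (fun y : Coord n => exp (-offMat y.1)) = (fun A : Matrix n n ℂ => exp A) ∘ (-offMatL) := by
      funext y; simp
    rw [this]; exact contDiff_exp_matrix.comp (-offMatL (n := n)).contDiff
  have h4 : ContDiff ℝ m (orbitMat (n := n)) := by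
    have : orbitMat (n := n) = fun y => exp (offMat y.1) * diagI y.2 * exp (-offMat y.1) := rfl
    rw [this]; exact (h1.mul h2).mul h3
  have : orbitMap (n := n) = fromMatL ∘ orbitMat := by funext y; simp [orbitMap]
  rw [this]; exact fromMatL.contDiff.comp h4

/-- `orbitDeriv = fderiv orbitMap`. [cite: Helgason2000, Ch. I §5 Thm. 5.17 (22) p0186] -/
theorem orbitDeriv_eq_fderiv : orbitDeriv (n := n) = fderiv ℝ orbitMap :=
  funext fun x => (hasFDerivAt_orbitMap x).fderiv.symm

/-- **The derivative of the orbit map depends continuously on the point** (the orbit map is `C¹`).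
[cite: Helgason2000, Ch. I §5 Thm. 5.17 (22) p0186] -/
theorem continuous_orbitDeriv : Continuous (orbitDeriv (n := n)) := by
  rw [orbitDeriv_eq_fderiv]
  exact (contDiff_orbitMap (m := 1)).continuous_fderiv one_ne_zero

/-- `x ↦ det(orbitDeriv x)` is continuous. [cite: Helgason2000, Ch. I §5 Thm. 5.17 (22) p0186] -/
theorem continuous_det_orbitDeriv : Continuous fun x : Coord n => (orbitDeriv x).det :=
  ContinuousLinearMap.continuous_det.comp continuous_orbitDeriv

/-- The orbit map is continuous. [cite: Helgason2000, Ch. I §5 Thm. 5.17 p0186] -/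
theorem continuous_orbitMap : Continuous (orbitMap (n := n)) := (contDiff_orbitMap (m := 1)).continuous

end Literature.RepresentationTheory.CompactGroups.WeylIntegration
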